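import Summits.QuantumFields.YangMills.Theorems.BalabanUVNodesN21GappedRoadRStepNeutral
import Summits.QuantumFields.YangMills.Theorems.BalabanUVNodesN21GappedPairRoadN20Invariance

/-!
# N21 (NE7c) · THE PAIR ROAD COSTS N20 NOTHING — width zero on BOTH grids gives n20-d's class weights OF RECORD (post-𝐑, by V4's weight-neutrality of the top 𝐑-step);
# hence `RelWeightBound` at dag-n21-w7's doubly-gapped carriers `(ρ, ρ′, n₁, n₂)` ⟺ `RelWeightBound` at the reading of record, for every policy cutting below the top

R134 seat `pub-ymgap-dag-n21-d` (g12, lane owner N21), strategy s2; key K3⁸ `SpineGivenEndpointR13SepCoPHV` = stmt-QuantumFields-27366, `--kind proof --supports 27366 --as helper`;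
COUNT-NEUTRAL.  Theorems only (0 `def`).  Imports V4 `…N21GappedRoadRStepNeutral` (the record's post-𝐑 class weight = the `ε`-lettered pre-𝐑 top weight, history by history, on the live
line) and V5a `…N21GappedPairRoadN20Invariance` (dial-freeness on the pair road); dag-n21-w7's `wTop2At ∕ topSlot2At ∕ topClassWeight2At ∕ topBLetter ∕ bCutGrid ∕ gapWeight2A∕B₁₃ ∕
crGap2₁₃VAt` BY NAME.  [III] = [Balaban1988Convergent], [LF-I∕II] = [Balaban1989LargeFieldI∕II].

WHAT IS PROVED (kernel; [bookkeeping]; NO estimate).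
§55 (run-generic) `wTop2At_eps_twoDelta_eq_wOfRecord₉` · `topSlot2At_eps_twoDelta_eq_tstepOfRecord` (`k ≠ p.K`) · `topClassWeight2At_eps_twoDelta_eq_topClassWeightAt_eps` · ★★
  `classWeightOfDatum₉_eq_topTerm2AtLevel_eps_twoDelta_of_ppSelLive` (level form `j ≤ p.K`, live line: the record's post-𝐑 class weight = the pair-lettered term at the letters OF
  RECORD `(ε_j, 2δ_{j−1})`).
§56 (at the `CoPH` record; rows `hsel` + (H-ζ)) `bCutGrid_width_zero` · ★★★ `weightA₁₃_eq_gapWeight2A₁₃_widthZero` ∕ `weightB₁₃_eq_gapWeight2B₁₃_widthZero` · ★★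
  `relWeightBound_record_iff_gap2Carriers_widthZero` · ★★★ `relWeightBound_gap2Carriers_iff_record` (policies `jcut K < K₀ + K ∨ jcut K = 0`) · `admW_gap2Carriers_eq_record` · ★★
  `wInf_gap2Carriers_eq_record` · ★★ `relWeightBound_crGap2₁₃VAt_iff_crOfRecord₁₃VAt` (N20's K5 face at the pair reading ⟺ at n20-d's reading of record, canonical weights, any `sh`).

HONEST FRAMING (binding).  Bookkeeping BY NAME; NO estimate of Bałaban's; N20's face itself NOT proved (K0⁷ OPEN); proved ON THE LIVE LINE only; NE7b ∕ NE7c NOT PRINTED for `d = 4`;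
N20 ∕ N21 NOT discharged; K3⁸ NOT claimed; counts UNMOVED (typed 28∕28 · discharged 5∕27); never a count claim.  No `sorry`, no `def`, no `instance`, no `notation`; standard axioms.
One finite four-torus programme at fixed `ε` — NOT ℝ⁴, NOT OS, NOT a mass gap, NOT the Clay problem.
-/

set_option autoImplicit false

noncomputable section

open scoped BigOperators
open Finset MeasureTheory

namespace Summit.QuantumFields.YangMills.Theorems.N21ShellSplitOfRecord13CoPH

open Literature.MathematicalPhysics.QuantumFieldTheory.Balaban1983to89
open Literature.MathematicalPhysics.QuantumFieldTheory.Balaban1983to89.T4Continuum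
open Literature.MathematicalPhysics.QuantumFieldTheory.Balaban1983to89.Node00
open B14.Eq218Concrete
open YMDAG.UVSplit (SpineReading₁₃CoPH crOfRecord₁₃VAt keyA₁₃ keyB₁₃ runA₁₃ runB₁₃ histA₁₃ histB₁₃ histA₁₃_zero histB₁₃_zero classSet₁₃ weightA₁₃ weightB₁₃ badClass₁₃
  ShellSplit₁₃CoPH)
open T4WeightBudget (RelWeightBound)
open Summit.QuantumFields.YangMills.BalabanUVNodes.SpineCanonicalWeights (admW wInf relWeightBound_wInf relWeightBound_wInf_iff)
open Summit.QuantumFields.YangMills.Theorems.N21StepWeightsPositivity (zetaOfRecord_nonneg)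
open Summit.QuantumFields.YangMills.Theorems.N21GappedTopPair13CoPH (topBLetter wTop2At topSlot2At topClassWeight2At topSlot2At_apply topTerm2AtLevel topTerm2AtLevel_zero
  topTerm2AtLevel_succ gapWeight2A₁₃ gapWeight2B₁₃ bCutGrid selDepthA2₁₃ selDepthB2₁₃ crGap2₁₃VAt)

/-! ## §55 Run-generic: at the letters OF RECORD `(ε_{k+1}, 2δ_k)` the pair-lettered objects are def-T's of record (pre-𝐑), hence the record's post-𝐑 class weights on the live line -/

section PreR2

variable (F : T4Family) (N : ℕ) [NeZero N] (ϑ : Stage9Params F N) (D : FiniteEpsData F (SU N)) (g₀ : ℕ → ℝ) (os : List (ULoop F))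
  (p : B12.RunParams) (g : ℕ → ℝ) (k : ℕ)

/-- At the letter pair of record `(ε_{k+1}, 2δ_k)` the pair-lettered step weights of step `k` ARE def-T's step weights of record (the 𝐓-step at `(p, g, k)` reads the (3.2) letter at
level `k + 1` and the (3.3) letter at level `k`, `wOfRecordAt_apply`; there both top letter families read the record's values whether or not `k + 1` is the top). [bookkeeping] -/
theorem wTop2At_eps_twoDelta_eq_wOfRecord₉ :
    wTop2At F N ϑ (epsOfRecord ϑ.ν g (k + 1)) (2 * deltaOfRecord ϑ.ν g k ϑ.A₁) p g k = wOfRecord₉ F N ϑ p g k := by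
  unfold wTop2At
  rw [show wOfRecord₉ F N ϑ = wOfRecordAt F N ϑ.ν ϑ.τ9.M (epsLetterOfRecord ϑ.ν) (twoDeltaLetterOfRecord ϑ.ν ϑ.A₁) ϑ.ζ from wOfRecord_eq_at F N ϑ.ν ϑ.τ9.M ϑ.A₁ ϑ.ζ,
    wOfRecordAt_apply, wOfRecordAt_apply]
  congr 1
  simp only [topLetter, epsLetterOfRecord, topBLetter, twoDeltaLetterOfRecord]
  split_ifs <;> rfl

/-- At `(θ, δ′) = (ε_{k+1}, 2δ_k)` (and `k ≠ p.K`) the pair-lettered slot IS def-T's pre-𝐑 𝐓-step of record of F3's dressed level-`k` slots. [bookkeeping] -/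
theorem topSlot2At_eps_twoDelta_eq_tstepOfRecord (hk : k ≠ p.K) (t : ℝ) (s' : SeqOfRecord F ϑ.ν ϑ.τ9.M g p.K (k + 1)) :
    topSlot2At F N ϑ D g₀ os p g k (epsOfRecord ϑ.ν g (k + 1)) (2 * deltaOfRecord ϑ.ν g k ϑ.A₁) t s' =
      tstepOfRecord F N ϑ.ν ϑ.τ9.M (wOfRecord₉ F N ϑ) p g k (dressedSlotsOfDatum₉ F N ϑ D g₀ os t p g k) s' := by
  funext V
  rw [topSlot2At_apply, tstepOfRecord_apply, wTop2At_eps_twoDelta_eq_wOfRecord₉, topLetter_of_ne ϑ.ν _ p g hk, ← chiSeqOfRecord_eq_at]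

/-- … so the pair-lettered class weight at `(ε_{k+1}, 2δ_k)` is T1's single-lettered one at `ε_{k+1}` (both are the integrated pre-𝐑 top term of record). [bookkeeping] -/
theorem topClassWeight2At_eps_twoDelta_eq_topClassWeightAt_eps (hk : k ≠ p.K) (t : ℝ) (s' : SeqOfRecord F ϑ.ν ϑ.τ9.M g p.K (k + 1)) :
    topClassWeight2At F N ϑ D g₀ os p g k (epsOfRecord ϑ.ν g (k + 1)) (2 * deltaOfRecord ϑ.ν g k ϑ.A₁) t s' =
      topClassWeightAt F N ϑ D g₀ os p g k (epsOfRecord ϑ.ν g (k + 1)) t s' := by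
  rw [topClassWeightAt_eps_eq_integral F N ϑ D g₀ os p g k hk t s']
  unfold topClassWeight2At
  rw [topSlot2At_eps_twoDelta_eq_tstepOfRecord F N ϑ D g₀ os p g k hk, ← chiSeqOfRecord_eq_at]

/-- ★★ **LEVEL FORM** (`j ≤ p.K`, live line; rows (H-ζ), `0 ≤ ζ`, `Σ|ζ| ≤ 1`, `D.AvgMeasurable`, `g 0 = g₀ p.K`, (e1) below the top): the record's post-𝐑 class weight at level `j` IS the
pair-lettered term at the letters of record `(ε_j, 2δ_{j−1})` — level `0`: both are the level-`0` weight; level `k + 1`: §55 + V4's weight-neutrality. [bookkeeping] -/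
theorem classWeightOfDatum₉_eq_topTerm2AtLevel_eps_twoDelta_of_ppSelLive (E : B12.RunParams → ℝ)
    (hsel : ϑ.ppSel = ppSelLiveOfRecord F N ϑ.ν ϑ.τ9 E (wOfRecord₉ F N ϑ)) (hg : g 0 = g₀ p.K) (hD : D.AvgMeasurable)
    (hζ0 : ∀ p g k s Pl Ql RS U V', 0 ≤ ϑ.ζ p g k s Pl Ql RS U V') (hζm : ZetaMeasurable F N ϑ.ζ) (hζ1 : IsZetaAbsLeOne F N ϑ.ν ϑ.τ9.M ϑ.ζ) (t : ℝ)
    (hint : ∀ k, k < p.K → ∀ s : SeqOfRecord F ϑ.ν ϑ.τ9.M g p.K k,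
      Integrable (fun U => chiSeqOfRecord F N ϑ.ν ϑ.τ9.M g p.K k s U * dressedSlotsOfDatum₉ F N ϑ D g₀ os t p g k s U) (fieldMeasure (F.P p.K) k (SU N))) :
    ∀ (j : ℕ), j ≤ p.K → ∀ s : SeqOfRecord F ϑ.ν ϑ.τ9.M g p.K j,
      classWeightOfDatum₉ F N ϑ D g₀ os p g j t s = topTerm2AtLevel F N ϑ D g₀ os p g (epsOfRecord ϑ.ν g j) (2 * deltaOfRecord ϑ.ν g (j - 1) ϑ.A₁) t j s := by
  intro j hj s
  cases j with
  | zero => simp only [topTerm2AtLevel_zero]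
  | succ k =>
    simp only [topTerm2AtLevel_succ, Nat.add_sub_cancel]
    rw [topClassWeight2At_eps_twoDelta_eq_topClassWeightAt_eps F N ϑ D g₀ os p g k (by omega) t s]
    exact classWeightOfDatum₉_succ_eq_topClassWeightAt_eps_of_ppSelLive F N ϑ D g₀ os p g k E hsel hg hD hζ0 hζm hζ1 (by omega) t s (hint k (by omega))

end PreR2

/-! ## §56 At the `CoPH`-keyed Stage-13 record: the record's class weights ARE the width-zero doubly-gapped weights; `RelWeightBound` at the pair carriers ⟺ at the record's -/

section Record2R

variable {F : T4Family} {N : ℕ} [NeZero N] (K₀ : ℕ) (θ : Stage13HParams F N) (hP : θ.Provisos₁₃CoPH F N) (g₀ : ℕ → ℝ) (os : List (ULoop F))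

omit [NeZero N] in
/-- At width `0` every letter of the (3.3) grid is print's `2δ_k`. [bookkeeping] -/
theorem bCutGrid_width_zero (ν : Stage7Numerics) (A₁ : ℝ) (g : ℕ → ℝ) (k j : ℕ) : bCutGrid ν A₁ g k 0 j = 2 * deltaOfRecord ν g k A₁ := by
  simp [bCutGrid]

/-- ★★★ **n20-d's RUN-A CLASS WEIGHT OF RECORD IS THE WIDTH-ZERO DOUBLY-GAPPED WEIGHT, EVERY KEY, EVERY DEPTH PAIR** (live line, (H-ζ)). [bookkeeping] -/
theorem weightA₁₃_eq_gapWeight2A₁₃_widthZero (E : B12.RunParams → ℝ) (hsel : θ.ppSel = ppSelLiveOfRecord F N θ.ν θ.τ9 E (wOfRecord₉ F N θ.toStage9Params))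
    (hζm : ZetaMeasurable F N θ.ζ) (n₁ n₂ : ℕ → ℕ) (K : ℕ) (t : ℝ) (x : Σ K, SiteSeqKey F (K₀ + K)) :
    weightA₁₃ θ hP K₀ g₀ os K t x = gapWeight2A₁₃ θ hP K₀ g₀ os (fun _ => 0) (fun _ => 0) n₁ n₂ K t x := by
  have hζ0 : ∀ p g k s Pl Ql RS U V', 0 ≤ θ.ζ p g k s Pl Ql RS U V' :=
    fun p g k s Pl Ql RS U V' => zetaOfRecord_nonneg F N θ.ν θ.τ9.M hP.zetaUnity hP.zetaAbs p g k s Pl Ql RS U V'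
  have hU : LocalBgMeasurable F N θ.ν := localBgMeasurable F N θ.ν
  have hD : (datumOfRecord₁₃CoPH F N θ hP).AvgMeasurable := (isPrintedAveraged_datumOfRecord₁₃CoPH F N θ hP).avgMeasurable
  unfold weightA₁₃ gapWeight2A₁₃
  refine Finset.sum_congr rfl fun s _ => ?_
  simp only [cutGrid_width_zero, bCutGrid_width_zero]
  exact classWeightOfDatum₉_eq_topTerm2AtLevel_eps_twoDelta_of_ppSelLive F N θ.toStage9Params (datumOfRecord₁₃CoPH F N θ hP) g₀ os (runA₁₃ F K₀ g₀ K)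
    (histA₁₃ θ K₀ g₀ K) E hsel (histA₁₃_zero θ K₀ g₀ K) hD hζ0 hζm hP.zetaAbs t
    (fun k hk s => integrable_chi_mul_dressedSlots_of_ppSelLive θ.toStage9Params E hsel hU hζm hζ0 hP.zetaAbs _ hD g₀ os (histA₁₃_zero θ K₀ g₀ K) t k s)
    (K₀ + K) le_rfl s

/-- ★★★ **… AND RUN B's.** [bookkeeping] -/
theorem weightB₁₃_eq_gapWeight2B₁₃_widthZero (E : B12.RunParams → ℝ) (hsel : θ.ppSel = ppSelLiveOfRecord F N θ.ν θ.τ9 E (wOfRecord₉ F N θ.toStage9Params))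
    (hζm : ZetaMeasurable F N θ.ζ) (n₁ n₂ : ℕ → ℕ) (K : ℕ) (t : ℝ) (x : Σ K, SiteSeqKey F (K₀ + K)) :
    weightB₁₃ θ hP K₀ g₀ os K t x = gapWeight2B₁₃ θ hP K₀ g₀ os (fun _ => 0) (fun _ => 0) n₁ n₂ K t x := by
  have hζ0 : ∀ p g k s Pl Ql RS U V', 0 ≤ θ.ζ p g k s Pl Ql RS U V' :=
    fun p g k s Pl Ql RS U V' => zetaOfRecord_nonneg F N θ.ν θ.τ9.M hP.zetaUnity hP.zetaAbs p g k s Pl Ql RS U V'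
  have hU : LocalBgMeasurable F N θ.ν := localBgMeasurable F N θ.ν
  have hD : (datumOfRecord₁₃CoPH F N θ hP).AvgMeasurable := (isPrintedAveraged_datumOfRecord₁₃CoPH F N θ hP).avgMeasurable
  unfold weightB₁₃ gapWeight2B₁₃
  refine Finset.sum_congr rfl fun s' _ => ?_
  simp only [cutGrid_width_zero, bCutGrid_width_zero]
  exact classWeightOfDatum₉_eq_topTerm2AtLevel_eps_twoDelta_of_ppSelLive F N θ.toStage9Params (datumOfRecord₁₃CoPH F N θ hP) g₀ os (runB₁₃ F K₀ g₀ K)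
    (histB₁₃ θ K₀ g₀ K) E hsel (histB₁₃_zero θ K₀ g₀ K) hD hζ0 hζm hP.zetaAbs t
    (fun k hk s => integrable_chi_mul_dressedSlots_of_ppSelLive θ.toStage9Params E hsel hU hζm hζ0 hP.zetaAbs _ hD g₀ os (histB₁₃_zero θ K₀ g₀ K) t k s)
    (K₀ + K + 1) le_rfl s'

/-- ★★ **`RelWeightBound` AT n20-d's CARRIERS OF RECORD ⟺ AT THE WIDTH-ZERO DOUBLY-GAPPED CARRIERS** (every `W`, every policy, every depth pair). [bookkeeping] -/
theorem relWeightBound_record_iff_gap2Carriers_widthZero (E : B12.RunParams → ℝ) (hsel : θ.ppSel = ppSelLiveOfRecord F N θ.ν θ.τ9 E (wOfRecord₉ F N θ.toStage9Params))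
    (hζm : ZetaMeasurable F N θ.ζ) (jcut : ℕ → ℕ) (n₁ n₂ : ℕ → ℕ) (W : ℕ → ℝ) :
    RelWeightBound 1 (classSet₁₃ θ K₀ g₀) (weightA₁₃ θ hP K₀ g₀ os) (weightB₁₃ θ hP K₀ g₀ os) (badClass₁₃ θ K₀ g₀ jcut) W ↔
      RelWeightBound 1 (classSet₁₃ θ K₀ g₀) (gapWeight2A₁₃ θ hP K₀ g₀ os (fun _ => 0) (fun _ => 0) n₁ n₂) (gapWeight2B₁₃ θ hP K₀ g₀ os (fun _ => 0) (fun _ => 0) n₁ n₂)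
        (badClass₁₃ θ K₀ g₀ jcut) W := by
  have hA : weightA₁₃ θ hP K₀ g₀ os = gapWeight2A₁₃ θ hP K₀ g₀ os (fun _ => 0) (fun _ => 0) n₁ n₂ :=
    funext fun K => funext fun t => funext fun x => weightA₁₃_eq_gapWeight2A₁₃_widthZero K₀ θ hP g₀ os E hsel hζm n₁ n₂ K t x
  have hB : weightB₁₃ θ hP K₀ g₀ os = gapWeight2B₁₃ θ hP K₀ g₀ os (fun _ => 0) (fun _ => 0) n₁ n₂ :=
    funext fun K => funext fun t => funext fun x => weightB₁₃_eq_gapWeight2B₁₃_widthZero K₀ θ hP g₀ os E hsel hζm n₁ n₂ K t x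
  rw [hA, hB]

/-- ★★★ **`RelWeightBound` AT THE DOUBLY-GAPPED CARRIERS ⟺ AT n20-d's CARRIERS OF RECORD — THE PAIR ROAD COSTS N20 NOTHING** (every `W`; policies `jcut K < K₀ + K ∨ jcut K = 0`;
live line; (H-ζ)). [bookkeeping] -/
theorem relWeightBound_gap2Carriers_iff_record (E : B12.RunParams → ℝ) (hsel : θ.ppSel = ppSelLiveOfRecord F N θ.ν θ.τ9 E (wOfRecord₉ F N θ.toStage9Params))
    (hζm : ZetaMeasurable F N θ.ζ) (jcut : ℕ → ℕ) (hj : ∀ K, jcut K < K₀ + K ∨ jcut K = 0) (ρ ρ' : ℕ → ℝ) (n₁ n₂ : ℕ → ℕ) (W : ℕ → ℝ) :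
    RelWeightBound 1 (classSet₁₃ θ K₀ g₀) (gapWeight2A₁₃ θ hP K₀ g₀ os ρ ρ' n₁ n₂) (gapWeight2B₁₃ θ hP K₀ g₀ os ρ ρ' n₁ n₂) (badClass₁₃ θ K₀ g₀ jcut) W ↔
      RelWeightBound 1 (classSet₁₃ θ K₀ g₀) (weightA₁₃ θ hP K₀ g₀ os) (weightB₁₃ θ hP K₀ g₀ os) (badClass₁₃ θ K₀ g₀ jcut) W :=
  (relWeightBound_gap2Carriers_iff θ hP K₀ g₀ os jcut E hsel hζm hj ρ ρ' n₁ n₂ (fun _ => 0) (fun _ => 0) n₁ n₂ W).trans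
    (relWeightBound_record_iff_gap2Carriers_widthZero K₀ θ hP g₀ os E hsel hζm jcut n₁ n₂ W).symm

/-- The admissible relative weights of the bad class are the SAME SET at the doubly-gapped carriers and at the carriers of record (policy `jcut K < K₀ + K ∨ jcut K = 0`).
[bookkeeping] -/
theorem admW_gap2Carriers_eq_record (E : B12.RunParams → ℝ) (hsel : θ.ppSel = ppSelLiveOfRecord F N θ.ν θ.τ9 E (wOfRecord₉ F N θ.toStage9Params))
    (hζm : ZetaMeasurable F N θ.ζ) (jcut : ℕ → ℕ) (ρ ρ' : ℕ → ℝ) (n₁ n₂ : ℕ → ℕ) (K : ℕ) (hj : jcut K < K₀ + K ∨ jcut K = 0) :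
    admW 1 (classSet₁₃ θ K₀ g₀) (gapWeight2A₁₃ θ hP K₀ g₀ os ρ ρ' n₁ n₂) (gapWeight2B₁₃ θ hP K₀ g₀ os ρ ρ' n₁ n₂) (badClass₁₃ θ K₀ g₀ jcut) K =
      admW 1 (classSet₁₃ θ K₀ g₀) (weightA₁₃ θ hP K₀ g₀ os) (weightB₁₃ θ hP K₀ g₀ os) (badClass₁₃ θ K₀ g₀ jcut) K := by
  have hA : weightA₁₃ θ hP K₀ g₀ os = gapWeight2A₁₃ θ hP K₀ g₀ os (fun _ => 0) (fun _ => 0) n₁ n₂ :=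
    funext fun K => funext fun t => funext fun x => weightA₁₃_eq_gapWeight2A₁₃_widthZero K₀ θ hP g₀ os E hsel hζm n₁ n₂ K t x
  have hB : weightB₁₃ θ hP K₀ g₀ os = gapWeight2B₁₃ θ hP K₀ g₀ os (fun _ => 0) (fun _ => 0) n₁ n₂ :=
    funext fun K => funext fun t => funext fun x => weightB₁₃_eq_gapWeight2B₁₃_widthZero K₀ θ hP g₀ os E hsel hζm n₁ n₂ K t x
  rw [hA, hB]
  ext w
  simp only [admW, Set.mem_setOf_eq]
  refine and_congr_right fun _ => forall_congr' fun t => forall_congr' fun _ => ?_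
  have hb := sum_badClass₁₃_gapWeight2_letter_free θ hP K₀ g₀ os jcut E hsel hζm K hj ρ ρ' n₁ n₂ (fun _ => 0) (fun _ => 0) n₁ n₂ t
  have hz := sum_classSet₁₃_gapWeight2_letter_free θ hP K₀ g₀ os E hsel hζm K ρ ρ' n₁ n₂ (fun _ => 0) (fun _ => 0) n₁ n₂ t
  rw [hb.1, hb.2, hz.1, hz.2]

/-- ★★ **THE CANONICAL RELATIVE WEIGHT OF THE BAD CLASS IS THE SAME NUMBER** at the doubly-gapped carriers and at the carriers of record. [bookkeeping] -/
theorem wInf_gap2Carriers_eq_record (E : B12.RunParams → ℝ) (hsel : θ.ppSel = ppSelLiveOfRecord F N θ.ν θ.τ9 E (wOfRecord₉ F N θ.toStage9Params))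
    (hζm : ZetaMeasurable F N θ.ζ) (jcut : ℕ → ℕ) (ρ ρ' : ℕ → ℝ) (n₁ n₂ : ℕ → ℕ) (K : ℕ) (hj : jcut K < K₀ + K ∨ jcut K = 0) :
    wInf 1 (classSet₁₃ θ K₀ g₀) (gapWeight2A₁₃ θ hP K₀ g₀ os ρ ρ' n₁ n₂) (gapWeight2B₁₃ θ hP K₀ g₀ os ρ ρ' n₁ n₂) (badClass₁₃ θ K₀ g₀ jcut) K =
      wInf 1 (classSet₁₃ θ K₀ g₀) (weightA₁₃ θ hP K₀ g₀ os) (weightB₁₃ θ hP K₀ g₀ os) (badClass₁₃ θ K₀ g₀ jcut) K := by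
  unfold wInf
  rw [admW_gap2Carriers_eq_record K₀ θ hP g₀ os E hsel hζm jcut ρ ρ' n₁ n₂ K hj]

/-- ★★ **N20's K5 FACE AT THE PAIR READING ⟺ AT THE READING OF RECORD**, at the two readings' CANONICAL weights, per tuple on the live line under (H-ζ), for policies `jcut K < K₀ + K ∨
jcut K = 0` (any shell split `sh`). [bookkeeping] -/
theorem relWeightBound_crGap2₁₃VAt_iff_crOfRecord₁₃VAt (jcut : ℕ → ℕ) (hj : ∀ K, jcut K < K₀ + K ∨ jcut K = 0) (ρ ρ' : WidthLetter₁₃CoPH N) (n₁ n₂ : DepthLetter₁₃CoPH N)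
    (sh : ShellSplit₁₃CoPH N K₀) (E : B12.RunParams → ℝ) (hsel : θ.ppSel = ppSelLiveOfRecord F N θ.ν θ.τ9 E (wOfRecord₉ F N θ.toStage9Params)) (hζm : ZetaMeasurable F N θ.ζ) :
    RelWeightBound (crGap2₁₃VAt N K₀ jcut ρ ρ' n₁ n₂ F θ hP g₀ os).l₀ (crGap2₁₃VAt N K₀ jcut ρ ρ' n₁ n₂ F θ hP g₀ os).T (crGap2₁₃VAt N K₀ jcut ρ ρ' n₁ n₂ F θ hP g₀ os).A
        (crGap2₁₃VAt N K₀ jcut ρ ρ' n₁ n₂ F θ hP g₀ os).B (crGap2₁₃VAt N K₀ jcut ρ ρ' n₁ n₂ F θ hP g₀ os).Bad (crGap2₁₃VAt N K₀ jcut ρ ρ' n₁ n₂ F θ hP g₀ os).W ↔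
      RelWeightBound (crOfRecord₁₃VAt K₀ jcut sh F θ hP g₀ os).l₀ (crOfRecord₁₃VAt K₀ jcut sh F θ hP g₀ os).T (crOfRecord₁₃VAt K₀ jcut sh F θ hP g₀ os).A
        (crOfRecord₁₃VAt K₀ jcut sh F θ hP g₀ os).B (crOfRecord₁₃VAt K₀ jcut sh F θ hP g₀ os).Bad (crOfRecord₁₃VAt K₀ jcut sh F θ hP g₀ os).W := by
  show RelWeightBound 1 (classSet₁₃ θ K₀ g₀)
      (gapWeight2A₁₃ θ hP K₀ g₀ os (ρ F θ hP g₀ os) (ρ' F θ hP g₀ os) (n₁ F θ hP g₀ os) (n₂ F θ hP g₀ os))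
      (gapWeight2B₁₃ θ hP K₀ g₀ os (ρ F θ hP g₀ os) (ρ' F θ hP g₀ os) (n₁ F θ hP g₀ os) (n₂ F θ hP g₀ os)) (badClass₁₃ θ K₀ g₀ jcut)
      (wInf 1 (classSet₁₃ θ K₀ g₀) (gapWeight2A₁₃ θ hP K₀ g₀ os (ρ F θ hP g₀ os) (ρ' F θ hP g₀ os) (n₁ F θ hP g₀ os) (n₂ F θ hP g₀ os))
        (gapWeight2B₁₃ θ hP K₀ g₀ os (ρ F θ hP g₀ os) (ρ' F θ hP g₀ os) (n₁ F θ hP g₀ os) (n₂ F θ hP g₀ os)) (badClass₁₃ θ K₀ g₀ jcut)) ↔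
    RelWeightBound 1 (classSet₁₃ θ K₀ g₀) (weightA₁₃ θ hP K₀ g₀ os) (weightB₁₃ θ hP K₀ g₀ os) (badClass₁₃ θ K₀ g₀ jcut)
      (wInf 1 (classSet₁₃ θ K₀ g₀) (weightA₁₃ θ hP K₀ g₀ os) (weightB₁₃ θ hP K₀ g₀ os) (badClass₁₃ θ K₀ g₀ jcut))
  rw [relWeightBound_wInf_iff, relWeightBound_wInf_iff]
  exact exists_congr fun W => relWeightBound_gap2Carriers_iff_record K₀ θ hP g₀ os E hsel hζm jcut hj _ _ _ _ W

end Record2R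

end Summit.QuantumFields.YangMills.Theorems.N21ShellSplitOfRecord13CoPH

end
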